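import Mathlib
import Summits.ValiantsHypothesis.ValiantsHypothesis.Theorems.SymmetroidPencilBasics
import Summits.ValiantsHypothesis.ValiantsHypothesis.Theorems.LacunarySymmetroidMatrixDescartesDefiniteWitness

/-!
# `MatrixDescartes`, line `Lift` — registered calibration `not_wLaw_two`: the (2,1)-configuration
# analogue of the `n = 2` V-law is FALSE

Crux `stmt-ValiantsHypothesis-18050` (`Theses.LacunarySymmetroid.MatrixDescartes`).  The line
`Lift` reduces the crux to two-sided pencils `X^e • J + ∑ₖ X^{dₖ} • Pₖ` (`Pₖ ⪰ 0` on both sides of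
the pivot exponent `e`, one constant real symmetric `J`).  Its V-law at `n = 2` (`stub_vLaw_two`,
tree): with ONE PSD exponent on each side of the pivot, a `2 × 2` pencil has at most `2 · 2`
distinct positive zeros of its determinant.  This file certifies in the kernel that the
configuration hypothesis of the V-law is load-bearing: with TWO PSD exponents below the pivot and
one above, `2 · 2` is exceeded at `n = 2`.

The witness (found by zero forcing, integerised): `e = 3`, `d₁ = 2`, `d₂ = 0`, `d₃ = 5`,
`J = [[620, −260], [−260, −2720]]`, `P₁ = v vᵀ` with `v = (20, 38)` (`= [[400, 760], [760, 1444]]`),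
`P₂ = a aᵀ + b bᵀ` with `a = (20, 32)`, `b = (15, 23)` (`= [[625, 985], [985, 1553]]`),
`Q = a' a'ᵀ + b' b'ᵀ` with `a' = (−9, 20)`, `b' = (−6, 13)` (`= [[117, −258], [−258, 569]]`).
The determinant of `t³ J + t² P₁ + P₂ + t⁵ Q` takes the signs `+, −, +, −, +, −, +` at
`t = 3/16 < 7/32 < 25/32 < 13/16 < 29/16 < 77/16 < 105`, so by the tree lemma
`le_card_posRoots_of_alternating` (intermediate value theorem on each gap) it has at least `6 > 4`
distinct positive roots (`WLawTwoWitness.six_le_card_posRoots_Fw`, `not_wLaw_two`).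

The witness data are written as local notations (no definitions); the PSD terms are given
directly as sums of rank-one squares `v vᵀ`, positive semidefinite by the tree lemma
`DefiniteWitness.posSemidef_vecMulVec_self`.

[folklore] Elementary; the sign pattern is a `norm_num` certificate at rational points.  Mathlib
plus the two tree lemmas named above (axioms `propext`, `Classical.choice`, `Quot.sound`).
-/

-- `Summit.ValiantsHypothesis.ValiantsHypothesis.…` repeats a component by the single-conjunct
-- summit layout, which the `dupNamespace` linter flags; the name is mandated.
set_option linter.dupNamespace false

namespace Summit.ValiantsHypothesis.ValiantsHypothesis.Theorems.LacunarySymmetroidMatrixDescartes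

open Summit.ValiantsHypothesis.ValiantsHypothesis.Theorems.SymmetroidDescartes
  (le_card_posRoots_of_alternating)
open scoped BigOperators Matrix
open Polynomial

/-- the constant indefinite letter `J = [[620, −260], [−260, −2720]]` (pivot exponent `e = 3`) -/
local notation3 (prettyPrint := false) "Jw" =>
  (!![620, -260; -260, -2720] : Matrix (Fin 2) (Fin 2) ℝ)

/-- the PSD term `P₁ = v vᵀ`, `v = (20, 38)` (`= [[400, 760], [760, 1444]]`, exponent `d₁ = 2`) -/
local notation3 (prettyPrint := false) "Pw₁" =>
  (Matrix.vecMulVec ![(20 : ℝ), 38] ![(20 : ℝ), 38] : Matrix (Fin 2) (Fin 2) ℝ)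

/-- the PSD term `P₂ = a aᵀ + b bᵀ`, `a = (20, 32)`, `b = (15, 23)` (`= [[625, 985], [985, 1553]]`,
exponent `d₂ = 0`) -/
local notation3 (prettyPrint := false) "Pw₂" =>
  (Matrix.vecMulVec ![(20 : ℝ), 32] ![(20 : ℝ), 32]
      + Matrix.vecMulVec ![(15 : ℝ), 23] ![(15 : ℝ), 23] : Matrix (Fin 2) (Fin 2) ℝ)

/-- the PSD term `Q = a' a'ᵀ + b' b'ᵀ`, `a' = (−9, 20)`, `b' = (−6, 13)`
(`= [[117, −258], [−258, 569]]`, exponent `d₃ = 5`) -/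
local notation3 (prettyPrint := false) "Qw" =>
  (Matrix.vecMulVec ![(-9 : ℝ), 20] ![(-9 : ℝ), 20]
      + Matrix.vecMulVec ![(-6 : ℝ), 13] ![(-6 : ℝ), 13] : Matrix (Fin 2) (Fin 2) ℝ)

/-- the witness pencil `F(X) = X³ • J + X² • P₁ + X⁰ • P₂ + X⁵ • Q`, in the currency of
`not_wLaw_two` -/
local notation3 (prettyPrint := false) "Fw" =>
  (((Polynomial.X : Polynomial ℝ) ^ 3) • (Jw).map Polynomial.C
    + ((Polynomial.X : Polynomial ℝ) ^ 2) • (Pw₁).map Polynomial.C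
    + ((Polynomial.X : Polynomial ℝ) ^ 0) • (Pw₂).map Polynomial.C
    + ((Polynomial.X : Polynomial ℝ) ^ 5) • (Qw).map Polynomial.C)

/-- seven positive test points `3/16 < 7/32 < 25/32 < 13/16 < 29/16 < 77/16 < 105` -/
local notation3 (prettyPrint := false) "τw" =>
  (![3/16, 7/32, 25/32, 13/16, 29/16, 77/16, 105] : Fin 7 → ℝ)

namespace WLawTwoWitness

/-- `P₁ ⪰ 0` (a rank-one square) -/
theorem Pw₁_posSemidef : (Pw₁).PosSemidef := DefiniteWitness.posSemidef_vecMulVec_self _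

/-- `P₂ ⪰ 0` (a sum of two rank-one squares) -/
theorem Pw₂_posSemidef : (Pw₂).PosSemidef :=
  (DefiniteWitness.posSemidef_vecMulVec_self _).add (DefiniteWitness.posSemidef_vecMulVec_self _)

/-- `Q ⪰ 0` (a sum of two rank-one squares) -/
theorem Qw_posSemidef : (Qw).PosSemidef :=
  (DefiniteWitness.posSemidef_vecMulVec_self _).add (DefiniteWitness.posSemidef_vecMulVec_self _)

/-- Evaluating the determinant of a four-term polynomial pencil at a real point `t` gives the
determinant of the correspondingly weighted real matrix (`det` commutes with the evaluation ring
homomorphism). -/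
theorem eval_det_pencil₄ {m : ℕ} (e d₁ d₂ d₃ : ℕ) (J P₁ P₂ Q : Matrix (Fin m) (Fin m) ℝ) (t : ℝ) :
    (Matrix.det (((X : ℝ[X]) ^ e) • J.map Polynomial.C + ((X : ℝ[X]) ^ d₁) • P₁.map Polynomial.C
        + ((X : ℝ[X]) ^ d₂) • P₂.map Polynomial.C + ((X : ℝ[X]) ^ d₃) • Q.map Polynomial.C)).eval t
      = Matrix.det (t ^ e • J + t ^ d₁ • P₁ + t ^ d₂ • P₂ + t ^ d₃ • Q) := by
  have h := RingHom.map_det (Polynomial.evalRingHom t)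
    (((X : ℝ[X]) ^ e) • J.map Polynomial.C + ((X : ℝ[X]) ^ d₁) • P₁.map Polynomial.C
        + ((X : ℝ[X]) ^ d₂) • P₂.map Polynomial.C + ((X : ℝ[X]) ^ d₃) • Q.map Polynomial.C)
  rw [Polynomial.coe_evalRingHom] at h
  rw [h]
  congr 1
  ext i j
  simp only [RingHom.mapMatrix_apply, Matrix.map_apply, Matrix.add_apply, Matrix.smul_apply,
    smul_eq_mul, Polynomial.coe_evalRingHom, Polynomial.eval_add,
    Polynomial.eval_mul, Polynomial.eval_pow, Polynomial.eval_X, Polynomial.eval_C]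

/-- `det F(t)` in closed form -/
theorem eval_det_Fw (t : ℝ) :
    (Matrix.det Fw).eval t =
      (620 * t ^ 3 + 400 * t ^ 2 + 625 + 117 * t ^ 5) *
          (-2720 * t ^ 3 + 1444 * t ^ 2 + 1553 + 569 * t ^ 5) -
        (-260 * t ^ 3 + 760 * t ^ 2 + 985 - 258 * t ^ 5) ^ 2 := by
  rw [eval_det_pencil₄, Matrix.det_fin_two]
  simp only [Matrix.add_apply, Matrix.smul_apply, Matrix.vecMulVec_apply, smul_eq_mul]
  simp
  ring

/-- the test points increase -/
theorem τw_strictMono : StrictMono τw := by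
  refine Fin.strictMono_iff_lt_succ.2 fun j => ?_
  fin_cases j <;> simp <;> norm_num

/-- the test points are positive -/
theorem τw_pos (j : Fin 7) : 0 < τw j := by
  fin_cases j <;> simp

/-- `det F` alternates in sign along the test points (signs `+,−,+,−,+,−,+`; a `norm_num`
certificate) -/
theorem altw (j : Fin 6) :
    (Matrix.det Fw).eval (τw j.castSucc) * (Matrix.det Fw).eval (τw j.succ) < 0 := by
  fin_cases j <;> simp only [eval_det_Fw] <;> simp <;> norm_num

/-- **`Z₊ ≥ 6`** for the (2,1)-configuration `2 × 2` witness. -/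
theorem six_le_card_posRoots_Fw :
    6 ≤ ((Matrix.det Fw).roots.toFinset.filter (fun t => 0 < t)).card :=
  le_card_posRoots_of_alternating _ 6 τw τw_strictMono τw_pos altw

end WLawTwoWitness

open WLawTwoWitness

/-- **The (2,1)-configuration analogue of the `n = 2` V-law is false.**  It is NOT true that every
`2 × 2` pencil `X^e • J + X^{d₁} • P₁ + X^{d₂} • P₂ + X^{d₃} • Q` with `P₁, P₂, Q ⪰ 0` and
`d₂ < d₁ < e < d₃` (two PSD exponents below the pivot, one above) has at most `2 · 2` distinct
positive zeros of its determinant: the witness pencil `Fw` (`e = 3`, `(d₁, d₂, d₃) = (2, 0, 5)`)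
has at least `6`. -/
theorem not_wLaw_two : ¬ ∀ (e d₁ d₂ d₃ : ℕ) (J P₁ P₂ Q : Matrix (Fin 2) (Fin 2) ℝ),
    P₁.PosSemidef → P₂.PosSemidef → Q.PosSemidef → d₂ < d₁ → d₁ < e → e < d₃ →
    ((Matrix.det (((Polynomial.X : Polynomial ℝ) ^ e) • J.map Polynomial.C
        + ((Polynomial.X : Polynomial ℝ) ^ d₁) • P₁.map Polynomial.C
        + ((Polynomial.X : Polynomial ℝ) ^ d₂) • P₂.map Polynomial.C
        + ((Polynomial.X : Polynomial ℝ) ^ d₃) • Q.map Polynomial.C)).roots.toFinset.filter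
          (fun t => 0 < t)).card ≤ 2 * 2 := by
  intro h
  have h6 := six_le_card_posRoots_Fw.trans
    (h 3 2 0 5 Jw Pw₁ Pw₂ Qw Pw₁_posSemidef Pw₂_posSemidef Qw_posSemidef (by norm_num) (by norm_num)
      (by norm_num))
  omega

end Summit.ValiantsHypothesis.ValiantsHypothesis.Theorems.LacunarySymmetroidMatrixDescartes
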